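import Literature.NumberTheory.EllipticCurves.CongruentNewformCuspForm
import Literature.NumberTheory.EllipticCurves.ModularSymbolsHeckeProofs
import Literature.NumberTheory.EllipticCurves.CuspFormTwist
import Literature.NumberTheory.EllipticCurves.CongruentNumberCurveLSeriesProofs
import Literature.NumberTheory.QuadraticFields.JacobiCharacterPrimitiveProofs
import Literature.NumberTheory.EllipticCurves.GaussSumJacobiChar
import HarnessLib

/-!
# `L(E_D, 1)` as a twisted modular symbol of the congruent-number newform (Birch's formula)

The `L`-VALUE side of hypothesis (H3) of the explicit route to
`Literature.NumberTheory.EllipticCurves.Tunnell1983_a_sq_propto_L_one` (endgame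
`TunnellWaldspurgerSymmetricFamilyProofs`): the Shintani lift delivers the diagonal coefficients as
sums of cusp-to-cusp periods `{∞, a/D}_φ` of the congruent-number newform `φ`
(`CongruentNewformCuspForm.congruentCuspForm`), and these must be recognised as `L(E_D, 1)`. With the
tree's modular symbols `{∞, r}_f = 2π ∫₀^∞ f(r + it) dt` (`ModularForms.modularSymbol`), Birch's
formula (`twisted_LValue_eq_holds`, PROVED in `ModularSymbolsHeckeProofs`) and the Jacobi character
`χ_D = (·/D)` (`QuadraticFields.jacobiChar`, primitive quadratic for `D` odd square-free,
`JacobiCharacterPrimitiveProofs`), we PROVE, for every odd square-free `D`: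

* `jacobiChar_mul_cuspCoeff_eq_lFunction` — **`χ_D(n) aₙ(φ) = aₙ(E_D)` for all `n`**
  (`E_D = congruentNumberCurve D : y² = x³ - D²x`): by `aₙ(E_D) = (D/n) aₙ(φ)`
  (`CongruentNewformCuspForm`), quadratic reciprocity `(D/n) = (n/D)` for `n ≡ 1 (mod 4)`, and
  `aₙ(φ) = Re S(n) = 0` for `n ≢ 1 (mod 4)`;
* `twistedLSeries_congruentCuspForm` — hence `L(φ, χ_D, s) = L(E_D, s)` as `L`-series;
* **`gaussSum_mul_entireLFunction_one`** — **`g(χ_D) · L(E_D, 1) = ∑_{a mod D} χ_D(a) {∞, a/D}_φ`**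
  (`g(χ_D) = ∑ χ_D(a) e(a/D)`, Mathlib `gaussSum`; `L(E_D, 1)` the tree's `entireLFunction`, which exists
  by `hasEntireLFunction_congruentNumberCurve_holds`), and the solved form
  `entireLFunction_one_eq_twistedSymbolSum` — `L(E_D, 1) = g(χ_D)⁻¹ ∑_a χ_D(a) {∞, a/D}_φ`.

For `D = 1` this reads `L(E, 1) = {∞, 0}_φ` (`entireLFunction_one_eq_modularSymbol_zero`).
No definitions, no named facts.

## References

* B. J. Birch, *Elliptic curves over `ℚ`: a progress report*, 1969 Number Theory Institute, AMS
  (1971) 396–400 (the formula for `L(f ⊗ χ, 1)`). [Birch1971]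
* B. Mazur, J. Tate, J. Teitelbaum, Invent. Math. 84 (1986), §I.8, (8.6). [MazurTateTeitelbaum1986Invent]
* J. B. Tunnell, Invent. Math. 72 (1983), p. 325. [Tunnell1983Congruent]
-/

noncomputable section

open scoped MatrixGroups ModularForm NumberTheorySymbols
open CongruenceSubgroup

namespace Literature.NumberTheory.EllipticCurves.Tunnell1983

open Literature.NumberTheory.EllipticCurves.ModularForms Literature.NumberTheory.QuadraticFields

variable {D : ℕ} [NeZero D]

/-- **`χ_D(n) aₙ(φ) = aₙ(E_D)`** for `D` odd square-free and every `n`. [cite: Tunnell1983Congruent, p. 325] -/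
theorem jacobiChar_mul_cuspCoeff_eq_lFunction (hodd : Odd D) (hsq : Squarefree D) (n : ℕ) :
    jacobiChar D n * cuspCoeff congruentCuspForm n = ((congruentNumberCurve D).LFunction n : ℂ) := by
  rw [lFunction_congruentNumberCurve_eq_jacobiSym_mul_cuspCoeff hsq n, jacobiChar_natCast]
  by_cases h4 : n % 4 = 1
  · rw [jacobiSym.quadratic_reciprocity_one_mod_four h4 hodd]
  · have h0 : cuspCoeff congruentCuspForm n = 0 := by
      rw [cuspCoeff_congruentCuspForm, qCoeffs_congruentPhi]
      simp [GaussianPrimary.primarySum_eq_zero_of_mod_four_ne_one h4]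
    rw [h0, mul_zero, mul_zero]

/-- **`L(φ, χ_D, s) = L(E_D, s)`** as `L`-series (`D` odd square-free). [cite: Tunnell1983Congruent, p. 325] -/
theorem twistedLSeries_congruentCuspForm (hodd : Odd D) (hsq : Squarefree D) (s : ℂ) :
    twistedLSeries congruentCuspForm (jacobiChar D) s = (congruentNumberCurve D).LSeries s := by
  unfold twistedLSeries WeierstrassCurve.LSeries
  congr 1
  funext n
  exact jacobiChar_mul_cuspCoeff_eq_lFunction hodd hsq n

/-- **Birch's formula for the congruent number curves**: `g(χ_D) · L(E_D, 1) = ∑_{a mod D} χ_D(a) {∞, a/D}_φ`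
for `D` odd square-free (`χ_D⁻¹ = χ_D`). [cite: Birch1971] -/
theorem gaussSum_mul_entireLFunction_one (hodd : Odd D) (hsq : Squarefree D) :
    gaussSum (jacobiChar D) (ZMod.stdAddChar (N := D)) * (congruentNumberCurve D).entireLFunction 1 =
      twistedSymbolSum congruentCuspForm (jacobiChar D) := by
  have hE : (congruentNumberCurve D).HasEntireLFunction := hasEntireLFunction_congruentNumberCurve_holds hsq
  have hinv : (jacobiChar D)⁻¹ = jacobiChar D := isQuadratic_jacobiChar.inv
  have h := twisted_LValue_eq_holds congruentCuspForm (m := D) (isPrimitive_jacobiChar hodd hsq)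
    ((congruentNumberCurve D).differentiable_entireLFunction hE) (fun s hs ↦ by
      rw [(congruentNumberCurve D).entireLFunction_eq_LSeries hE (by linarith),
        twistedLSeries_congruentCuspForm hodd hsq])
  rwa [hinv] at h

/-- The Gauss sum of `χ_D` is nonzero (`D` odd square-free). [folklore] -/
theorem gaussSum_jacobiChar_ne_zero (hodd : Odd D) (hsq : Squarefree D) :
    gaussSum (jacobiChar D) (ZMod.stdAddChar (N := D)) ≠ 0 := by
  have h := gaussSum_stdAddChar_ne_zero_of_isPrimitive (isPrimitive_inv (isPrimitive_jacobiChar hodd hsq))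
  rwa [isQuadratic_jacobiChar.inv] at h

/-- **`L(E_D, 1) = g(χ_D)⁻¹ ∑_{a mod D} χ_D(a) {∞, a/D}_φ`** (`D` odd square-free). [cite: Birch1971] -/
theorem entireLFunction_one_eq_twistedSymbolSum (hodd : Odd D) (hsq : Squarefree D) :
    (congruentNumberCurve D).entireLFunction 1 =
      (gaussSum (jacobiChar D) (ZMod.stdAddChar (N := D)))⁻¹ * twistedSymbolSum congruentCuspForm (jacobiChar D) := by
  rw [← gaussSum_mul_entireLFunction_one hodd hsq, ← mul_assoc,
    inv_mul_cancel₀ (gaussSum_jacobiChar_ne_zero hodd hsq), one_mul]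


/-! ### With Gauss's sign: `√D · L(E_D, 1)` resp. `i√D · L(E_D, 1)` as the Birch sum -/

/-- **`√D · L(E_D, 1) = ∑_{a mod D} χ_D(a) {∞, a/D}_φ`** for `D ≡ 1 (mod 4)` square-free: Birch's formula
with Gauss's sign `τ(χ_D) = √D` (`GaussSumJacobiChar`). This is the form in which the diagonal Shintani
coefficient is matched, with a `D`-INDEPENDENT constant.
[cite: Birch1971] [cite: MontgomeryVaughan2007, §9.3, Thm. 9.17] -/
theorem sqrt_mul_entireLFunction_one_of_mod_four_eq_one (hsq : Squarefree D) (hD : D % 4 = 1) :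
    (Real.sqrt D : ℂ) * (congruentNumberCurve D).entireLFunction 1 =
      twistedSymbolSum congruentCuspForm (jacobiChar D) := by
  rw [← gaussSum_jacobiChar_of_mod_four_eq_one hsq hD]
  exact gaussSum_mul_entireLFunction_one (Nat.odd_iff.mpr (by omega)) hsq

/-- **`i√D · L(E_D, 1) = ∑_{a mod D} χ_D(a) {∞, a/D}_φ`** for `D ≡ 3 (mod 4)` square-free (`τ(χ_D) = i√D`).
[cite: Birch1971] [cite: MontgomeryVaughan2007, §9.3, Thm. 9.17] -/
theorem I_mul_sqrt_mul_entireLFunction_one_of_mod_four_eq_three (hsq : Squarefree D) (hD : D % 4 = 3) :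
    Complex.I * (Real.sqrt D : ℂ) * (congruentNumberCurve D).entireLFunction 1 =
      twistedSymbolSum congruentCuspForm (jacobiChar D) := by
  rw [← gaussSum_jacobiChar_of_mod_four_eq_three hsq hD]
  exact gaussSum_mul_entireLFunction_one (Nat.odd_iff.mpr (by omega)) hsq

/-- Solved form, `D ≡ 1 (mod 4)` square-free: `L(E_D, 1) = (∑_a χ_D(a) {∞, a/D}_φ)/√D`. [cite: Birch1971] -/
theorem entireLFunction_one_eq_twistedSymbolSum_div_sqrt (hsq : Squarefree D) (hD : D % 4 = 1) :
    (congruentNumberCurve D).entireLFunction 1 =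
      twistedSymbolSum congruentCuspForm (jacobiChar D) / (Real.sqrt D : ℂ) := by
  rw [← sqrt_mul_entireLFunction_one_of_mod_four_eq_one hsq hD, mul_div_cancel_left₀ _ (sqrt_natCast_ne_zero (NeZero.ne D))]

/-- Solved form, `D ≡ 3 (mod 4)` square-free: `L(E_D, 1) = (∑_a χ_D(a) {∞, a/D}_φ)/(i√D)`. [cite: Birch1971] -/
theorem entireLFunction_one_eq_twistedSymbolSum_div_I_sqrt (hsq : Squarefree D) (hD : D % 4 = 3) :
    (congruentNumberCurve D).entireLFunction 1 =
      twistedSymbolSum congruentCuspForm (jacobiChar D) / (Complex.I * (Real.sqrt D : ℂ)) := by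
  rw [← I_mul_sqrt_mul_entireLFunction_one_of_mod_four_eq_three hsq hD,
    mul_div_cancel_left₀ _ (mul_ne_zero Complex.I_ne_zero (sqrt_natCast_ne_zero (NeZero.ne D)))]

omit [NeZero D] in
/-- **`L(E, 1) = {∞, 0}_φ = 2π ∫₀^∞ φ(it) dt`** (`E : y² = x³ - x`). [cite: Tunnell1983Congruent, p. 325] -/
theorem entireLFunction_one_eq_modularSymbol_zero :
    (congruentNumberCurve 1).entireLFunction 1 = modularSymbol congruentCuspForm 0 := by
  have hE : (congruentNumberCurve 1).HasEntireLFunction := hasEntireLFunction_congruentNumberCurve_holds squarefree_one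
  symm
  refine modularSymbol_zero_eq_holds congruentCuspForm ((congruentNumberCurve 1).differentiable_entireLFunction hE)
    fun s hs ↦ ?_
  rw [(congruentNumberCurve 1).entireLFunction_eq_LSeries hE (by linarith), cuspFormLSeries_congruentCuspForm]

end Literature.NumberTheory.EllipticCurves.Tunnell1983

end
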